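import Summits.AtomisticToContinuum.FouriersLaw.Theorems.EmbeddedDrudeMourreGreenKuboContinuationMnTestFunctions
import HarnessLib

/-!
# From Chebyshev test polynomials to compactly supported test functions, carrier `[-R, R]`

Helper for the line `FilterInvariance` of the crux `EmbeddedDrudeMourre.GreenKuboContinuation`
(stub `stub_mnTestFunctionsR`, the finite-moment generalisation of `stub_mnTestFunctions`).

Setting: `τ` is a finite measure on `ℝ` carried by `[-R, R]` for some real `R` (possibly `R > 1`:
point masses outside the band `[-1, 1]` are allowed; if `R < 0` then `τ = 0`); `F n` are continuous
"test densities" with a uniform `L¹(τ)` bound, converging uniformly on every `[-1+δ, 1-δ]` to `S`;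
and `∫ T_m F_n dτ → ∫_{-1}^{1} T_m w` for every Chebyshev polynomial `T_m`, `w` continuous.

Conclusion: `∫ f S dτ = ∫_{-1}^{1} f w` for every continuous `f` compactly supported inside `(-1, 1)`.

Proof: verbatim the `[-1, 1]` case
(`EmbeddedDrudeMourreGreenKuboContinuationMnTestFunctions`), whose left-limit lemma
`mnTest_tendsto_left` (uniform convergence on the support, dominated convergence) does not involve
the carrier of `τ` and is reused as is. The right-limit chain is redone for the carrier `[-R, R]`:
* `mnTestR_integrable_of_continuous`: continuous functions are `τ`-integrable (bounded on the
  compact carrier `[-R, R]`);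
* `mnTestR_tendsto_integral_poly`: the Chebyshev polynomials span `ℝ[X]`, so the tested limits
  hold for every polynomial;
* `mnTestR_tendsto_right`: Weierstrass approximation of `f` on the single interval `[-R', R']`,
  `R' = max R 1`, which contains both the carrier `[-R, R]` of `τ` (for the `L¹(τ)` estimate) and
  `[-1, 1]` (for the `w`-side estimate); `ε / 3` argument.
* Uniqueness of limits.
-/

noncomputable section

namespace Summit.AtomisticToContinuum.FouriersLaw.Theorems.GreenKuboContinuation.BandLimitedKrylov

open Filter Topology MeasureTheory Set Polynomial

/-! ### Integrability against a finite measure carried by `[-R, R]` -/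

/-- `τ`-almost every point lies in `[-R, R]` if `τ` does not charge the complement of `[-R, R]`. -/
theorem mnTestR_ae_mem_Icc {τ : Measure ℝ} {R : ℝ} (hτ : τ (Set.Icc (-R) R)ᶜ = 0) :
    ∀ᵐ ω ∂τ, ω ∈ Set.Icc (-R) R := by
  filter_upwards [mem_ae_iff.2 hτ] with ω hω using hω

/-- A continuous function is integrable against a finite measure carried by `[-R, R]`
(it is bounded on the compact interval `[-R, R]`). -/
theorem mnTestR_integrable_of_continuous {τ : Measure ℝ} [IsFiniteMeasure τ] {R : ℝ}
    (hτ : τ (Set.Icc (-R) R)ᶜ = 0) {g : ℝ → ℝ} (hg : Continuous g) : Integrable g τ := by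
  obtain ⟨B, hB⟩ := isCompact_Icc.exists_bound_of_continuousOn
    (hg.continuousOn (s := Set.Icc (-R) R))
  exact Integrable.of_bound hg.aestronglyMeasurable B
    ((mnTestR_ae_mem_Icc hτ).mono fun ω hω => hB ω hω)

/-! ### Polynomial test functions -/

/-- **Polynomial test functions (carrier `[-R, R]`).** If `∫ T_m F_n dτ → ∫_{-1}^1 T_m w` for
every Chebyshev polynomial `T_m` (`m : ℕ`), then `∫ P F_n dτ → ∫_{-1}^1 P w` for every polynomial
`P`: the `T_m` span `ℝ[X]` (their leading coefficients `2^(m-1)` are units) and both sides are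
linear in the test polynomial. -/
theorem mnTestR_tendsto_integral_poly {τ : Measure ℝ} [IsFiniteMeasure τ] {R : ℝ}
    (hτ : τ (Set.Icc (-R) R)ᶜ = 0) {F : ℕ → ℝ → ℝ} {w : ℝ → ℝ}
    (hF : ∀ n, Continuous (F n)) (hw : Continuous w)
    (hcheb : ∀ m : ℕ, Tendsto (fun n : ℕ => ∫ ω, (Polynomial.Chebyshev.T ℝ m).eval ω * F n ω ∂τ)
      atTop (𝓝 (∫ x in (-1 : ℝ)..1, (Polynomial.Chebyshev.T ℝ m).eval x * w x)))
    (P : ℝ[X]) :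
    Tendsto (fun n : ℕ => ∫ ω, P.eval ω * F n ω ∂τ) atTop
      (𝓝 (∫ x in (-1 : ℝ)..1, P.eval x * w x)) := by
  have hunit : ∀ i, IsUnit ((Chebyshev.chebyshevTsequence ℝ) i).leadingCoeff := fun i =>
    isUnit_iff_ne_zero.2 (leadingCoeff_ne_zero.2 ((Chebyshev.chebyshevTsequence ℝ).ne_zero i))
  have hP : P ∈ Submodule.span ℝ (Set.range (Chebyshev.chebyshevTsequence ℝ)) := by
    rw [(Chebyshev.chebyshevTsequence ℝ).span hunit]
    exact Submodule.mem_top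
  induction hP using Submodule.span_induction with
  | mem Q hQ =>
    obtain ⟨m, rfl⟩ := hQ
    exact hcheb m
  | zero =>
    simp only [eval_zero, zero_mul, integral_zero, intervalIntegral.integral_zero]
    exact tendsto_const_nhds
  | add Q Q' _ _ hQ hQ' =>
    have h1 : ∀ n, Integrable (fun ω => Q.eval ω * F n ω) τ := fun n =>
      mnTestR_integrable_of_continuous hτ (Q.continuous.fun_mul (hF n))
    have h2 : ∀ n, Integrable (fun ω => Q'.eval ω * F n ω) τ := fun n =>
      mnTestR_integrable_of_continuous hτ (Q'.continuous.fun_mul (hF n))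
    simp only [eval_add, add_mul]
    rw [intervalIntegral.integral_add ((Q.continuous.fun_mul hw).intervalIntegrable _ _)
      ((Q'.continuous.fun_mul hw).intervalIntegrable _ _)]
    exact (hQ.add hQ').congr fun n => (integral_add (h1 n) (h2 n)).symm
  | smul a Q _ hQ =>
    simp only [eval_smul, smul_eq_mul, mul_assoc, integral_const_mul,
      intervalIntegral.integral_const_mul]
    exact hQ.const_mul a

/-! ### The right limit: Weierstrass on `[-max R 1, max R 1]` and the `L¹(τ)` bound -/

/-- **Right limit (carrier `[-R, R]`).** If `∫ P F_n dτ → ∫_{-1}^1 P w` for every polynomial `P`,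
the `F_n` are continuous with `∫ |F_n| dτ ≤ C`, `τ` is carried by `[-R, R]`, and `w`, `f` are
continuous, then `∫ f F_n dτ → ∫_{-1}^1 f w`: approximate `f` uniformly by a polynomial on
`[-R', R']`, `R' = max R 1`, an interval containing both `[-R, R]` and `[-1, 1]`; `ε / 3` argument. -/
theorem mnTestR_tendsto_right {τ : Measure ℝ} [IsFiniteMeasure τ] {R : ℝ}
    (hτ : τ (Set.Icc (-R) R)ᶜ = 0) {F : ℕ → ℝ → ℝ} {w f : ℝ → ℝ}
    (hF : ∀ n, Continuous (F n)) (hw : Continuous w)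
    (hL1 : ∃ C : ℝ, ∀ n, ∫ ω, |F n ω| ∂τ ≤ C)
    (hpoly : ∀ P : ℝ[X], Tendsto (fun n : ℕ => ∫ ω, P.eval ω * F n ω ∂τ) atTop
      (𝓝 (∫ x in (-1 : ℝ)..1, P.eval x * w x)))
    (hf : Continuous f) :
    Tendsto (fun n : ℕ => ∫ ω, f ω * F n ω ∂τ) atTop
      (𝓝 (∫ x in (-1 : ℝ)..1, f x * w x)) := by
  obtain ⟨C₁, hC₁⟩ := hL1
  have hC0 : 0 ≤ C₁ := (integral_nonneg fun ω => abs_nonneg _).trans (hC₁ 0)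
  obtain ⟨Bw, hBw⟩ := isCompact_Icc.exists_bound_of_continuousOn
    (hw.continuousOn (s := Set.Icc (-1 : ℝ) 1))
  have hBw0 : 0 ≤ Bw := (norm_nonneg _).trans (hBw 0 (by norm_num))
  -- the common compact interval `[-R', R']`, `R' = max R 1`
  set R' : ℝ := max R 1 with hR'
  have hsubτ : Set.Icc (-R) R ⊆ Set.Icc (-R') R' :=
    Set.Icc_subset_Icc (neg_le_neg (le_max_left R 1)) (le_max_left R 1)
  have hsub1 : Set.Icc (-1 : ℝ) 1 ⊆ Set.Icc (-R') R' :=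
    Set.Icc_subset_Icc (neg_le_neg (le_max_right R 1)) (le_max_right R 1)
  rw [Metric.tendsto_atTop]
  intro ε hε
  -- accuracy of the polynomial approximation
  have hden : 0 < C₁ + 2 * Bw + 1 := by linarith
  set η : ℝ := ε / (3 * (C₁ + 2 * Bw + 1)) with hη
  have hη0 : 0 < η := div_pos hε (by linarith)
  have hkey : η * (C₁ + 2 * Bw + 1) = ε / 3 := by
    rw [hη, div_mul_eq_mul_div, mul_div_mul_right _ _ hden.ne']
  have hηC : η * C₁ ≤ ε / 3 := by
    rw [← hkey]
    exact mul_le_mul_of_nonneg_left (by linarith) hη0.le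
  have hηw : η * Bw * 2 ≤ ε / 3 := by
    rw [← hkey, mul_assoc]
    exact mul_le_mul_of_nonneg_left (by linarith) hη0.le
  obtain ⟨P, hP⟩ := exists_polynomial_near_of_continuousOn (-R') R' f hf.continuousOn η hη0
  obtain ⟨N, hN⟩ := Metric.tendsto_atTop.1 (hpoly P) (ε / 3) (by positivity)
  refine ⟨N, fun n hn => ?_⟩
  -- (1) `∫ f F_n dτ` is `ε/3`-close to `∫ P F_n dτ`, uniformly in `n` (estimate on `[-R, R]`)
  have h1 : dist (∫ ω, f ω * F n ω ∂τ) (∫ ω, P.eval ω * F n ω ∂τ) ≤ ε / 3 := by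
    rw [dist_eq_norm, ← integral_sub (mnTestR_integrable_of_continuous hτ (hf.fun_mul (hF n)))
      (mnTestR_integrable_of_continuous hτ (P.continuous.fun_mul (hF n)))]
    calc ‖∫ ω, (f ω * F n ω - P.eval ω * F n ω) ∂τ‖
        ≤ ∫ ω, η * |F n ω| ∂τ := by
          refine norm_integral_le_of_norm_le
            (((mnTestR_integrable_of_continuous hτ (hF n)).abs).const_mul η) ?_
          filter_upwards [mnTestR_ae_mem_Icc hτ] with ω hω
          rw [Real.norm_eq_abs, ← sub_mul, abs_mul]
          refine mul_le_mul_of_nonneg_right ?_ (abs_nonneg _)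
          rw [abs_sub_comm]
          exact (hP ω (hsubτ hω)).le
      _ = η * ∫ ω, |F n ω| ∂τ := integral_const_mul _ _
      _ ≤ η * C₁ := mul_le_mul_of_nonneg_left (hC₁ n) hη0.le
      _ ≤ ε / 3 := hηC
  -- (2) `∫ P F_n dτ` is eventually `ε/3`-close to `∫_{-1}^1 P w`
  have h2 : dist (∫ ω, P.eval ω * F n ω ∂τ) (∫ x in (-1 : ℝ)..1, P.eval x * w x) < ε / 3 :=
    hN n hn
  -- (3) `∫_{-1}^1 P w` is `ε/3`-close to `∫_{-1}^1 f w` (estimate on `[-1, 1]`)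
  have h3 : dist (∫ x in (-1 : ℝ)..1, P.eval x * w x) (∫ x in (-1 : ℝ)..1, f x * w x) ≤ ε / 3 := by
    rw [dist_eq_norm, ← intervalIntegral.integral_sub
      ((P.continuous.fun_mul hw).intervalIntegrable _ _) ((hf.fun_mul hw).intervalIntegrable _ _)]
    calc ‖∫ x in (-1 : ℝ)..1, (P.eval x * w x - f x * w x)‖
        ≤ η * Bw * |(1 : ℝ) - (-1)| := by
          refine intervalIntegral.norm_integral_le_of_norm_le_const fun x hx => ?_
          have hx' : x ∈ Set.Icc (-1 : ℝ) 1 := by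
            rw [Set.uIoc_of_le (by norm_num)] at hx
            exact Set.Ioc_subset_Icc_self hx
          rw [Real.norm_eq_abs, ← sub_mul, abs_mul]
          exact mul_le_mul (hP x (hsub1 hx')).le (hBw x hx') (abs_nonneg _) hη0.le
      _ = η * Bw * 2 := by norm_num
      _ ≤ ε / 3 := hηw
  calc dist (∫ ω, f ω * F n ω ∂τ) (∫ x in (-1 : ℝ)..1, f x * w x)
      ≤ dist (∫ ω, f ω * F n ω ∂τ) (∫ ω, P.eval ω * F n ω ∂τ)
        + dist (∫ ω, P.eval ω * F n ω ∂τ) (∫ x in (-1 : ℝ)..1, P.eval x * w x)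
        + dist (∫ x in (-1 : ℝ)..1, P.eval x * w x) (∫ x in (-1 : ℝ)..1, f x * w x) :=
        dist_triangle4 _ _ _ _
    _ < ε / 3 + ε / 3 + ε / 3 := by linarith
    _ = ε := by ring

/-! ### The stub -/

/-- **`stub_mnTestFunctionsR` — from Chebyshev test polynomials to compactly supported test
functions, for a measure carried by `[-R, R]`.** Let `τ` be a finite measure carried by `[-R, R]`
(`R` any real), `F_n` continuous functions with `sup_n ∫ |F_n| dτ < ∞`, converging uniformly on
every `[-1+δ, 1-δ]` to `S`, and such that `∫ T_m F_n dτ → ∫_{-1}^{1} T_m w` for every Chebyshev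
polynomial `T_m` (`w` continuous). Then `∫ f S dτ = ∫_{-1}^{1} f w` for every continuous `f` with
compact support inside `(-1, 1)` (Chebyshev polynomials span `ℝ[X]`; Weierstrass on
`[-max R 1, max R 1]`; an `ε/3` argument with the `L¹(τ)` bound; on `tsupport f` the convergence
`F_n → S` is uniform, `mnTest_tendsto_left`; uniqueness of limits). [folklore] -/
theorem stub_mnTestFunctionsR :
    ∀ (τ : Measure ℝ) (R : ℝ), IsFiniteMeasure τ → τ (Set.Icc (-R) R)ᶜ = 0 →
      ∀ (F : ℕ → ℝ → ℝ) (S w : ℝ → ℝ),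
        (∀ n, Continuous (F n)) → Continuous w →
        (∃ C : ℝ, ∀ n, ∫ ω, |F n ω| ∂τ ≤ C) →
        (∀ δ : ℝ, 0 < δ → TendstoUniformlyOn F S atTop (Set.Icc (-1 + δ) (1 - δ))) →
        (∀ m : ℕ, Tendsto (fun n : ℕ => ∫ ω, (Polynomial.Chebyshev.T ℝ m).eval ω * F n ω ∂τ)
          atTop (𝓝 (∫ x in (-1 : ℝ)..1, (Polynomial.Chebyshev.T ℝ m).eval x * w x))) →
        ∀ f : ℝ → ℝ, Continuous f → HasCompactSupport f → tsupport f ⊆ Set.Ioo (-1) 1 →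
          ∫ ω, f ω * S ω ∂τ = ∫ x in (-1 : ℝ)..1, f x * w x := by
  intro τ R hfin hτ F S w hF hw hL1 hunif hcheb f hf hfc hfK
  haveI := hfin
  exact tendsto_nhds_unique (mnTest_tendsto_left hF hunif hf hfc hfK)
    (mnTestR_tendsto_right hτ hF hw hL1 (mnTestR_tendsto_integral_poly hτ hF hw hcheb) hf)

end Summit.AtomisticToContinuum.FouriersLaw.Theorems.GreenKuboContinuation.BandLimitedKrylov

end
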